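import Summits.AtomisticToContinuum.BoseEinsteinCondensation.Theses.BECStronglyRayleigh
import Summits.AtomisticToContinuum.BoseEinsteinCondensation.Theorems.InsertionFieldDelocalisation.Negative.Toolkit
import Summits.AtomisticToContinuum.BoseEinsteinCondensation.Theorems.InsertionFieldDelocalisation.Negative.Tightness
import Summits.AtomisticToContinuum.BoseEinsteinCondensation.Theorems.BECStronglyRayleighSectorGroundStatePerron
import HarnessLib

/-!
# Negative-lane toolkit for crux `InsertionFieldDelocalisation` (stmt-AtomisticToContinuum-9673), VII:
# the void-radius shells of line `mobile-trap-dirichlet-eigenfunction`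

Supports (does not close) stmt-AtomisticToContinuum-9673; nothing here asserts a Theses statement or a
stub (drefute seat; small facts every prover of `stub_voidTail` / `stub_annealedGain` / `stub_transfer`
of `Cruxes/InsertionFieldDelocalisation/Lines/mobile_trap_dirichlet_eigenfunction.lean` has to dispose
of).  The stubs use the raw expression `ρ_T(x) = ((T.image fun t => (torusGraph 3 L).dist x t).min.untopD 0)`
(graph distance to the nearest particle of `T`, `0` for `T = ∅`); we keep it raw.

* `voidRadius_eq_zero_iff` — `ρ_T(x) = 0 ↔ T = ∅ ∨ x ∈ T` (torus graph connected): the `R = 0` shell is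
  the pair sector `N = 2` plus the occupied sites, where the insertion field vanishes
  (`field_eq_zero_of_voidRadius_eq_zero`).
* `voidRadius_lt_card` — `ρ_T(x) < L³` (a geodesic is a path), whence the SHELL PARTITION
  `shell_partition`: `Σ_x f x = Σ_{R < L³} Σ_x [ρ_T(x) = R] f x`, the first step of `stub_transfer`, and
  the TAIL/SHELL bookkeeping `shell_le_tail`: `Σ_x [ρ_T(x) = R+1] w x ≤ Σ_x [R < ρ_T(x)] w x` for `w ≥ 0`.
-/

noncomputable section

namespace Summit.AtomisticToContinuum.BoseEinsteinCondensation.Theorems.InsertionFieldDelocalisation.Negative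

open scoped BigOperators ComplexOrder
open Literature.MathematicalPhysics.QuantumLattice Literature.Probability.LatticeModels Matrix Finset
open Summit.AtomisticToContinuum.BoseEinsteinCondensation.Theses.BECStronglyRayleigh
open Summit.AtomisticToContinuum.BoseEinsteinCondensation.Theorems.BECStronglyRayleighSectorPerron
  (torusGraph_connected)

variable {L : ℕ}

/-- **The `R = 0` shell.** `ρ_T(x) = 0` iff `T = ∅` or `x ∈ T`. [folklore] -/
theorem voidRadius_eq_zero_iff (T : Finset (TorusSite 3 L)) (x : TorusSite 3 L) :
    ((T.image fun t => (torusGraph 3 L).dist x t).min.untopD 0) = 0 ↔ T = ∅ ∨ x ∈ T := by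
  constructor
  · intro h
    by_cases hT : T = ∅
    · exact Or.inl hT
    · right
      obtain ⟨t₀, ht₀⟩ := Finset.nonempty_iff_ne_empty.mpr hT
      obtain ⟨b, hb⟩ :=
        Finset.min_of_mem (Finset.mem_image_of_mem (fun t => (torusGraph 3 L).dist x t) ht₀)
      rw [hb] at h
      change b = 0 at h
      subst h
      obtain ⟨t, ht, htb⟩ := Finset.mem_image.mp (Finset.mem_of_min hb)
      have hxt : x = t := by
        by_contra hne
        exact (Nat.pos_iff_ne_zero.mp ((torusGraph_connected 3 L).pos_dist_of_ne hne)) htb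
      rwa [hxt]
  · rintro (rfl | hx)
    · rw [Finset.image_empty, Finset.min_empty, WithTop.untopD_top]
    · have hmin : (T.image fun t => (torusGraph 3 L).dist x t).min = ((0 : ℕ) : WithTop ℕ) := by
        apply le_antisymm
        · exact Finset.min_le (Finset.mem_image.mpr ⟨x, hx, SimpleGraph.dist_self⟩)
        · exact Finset.le_min fun b _ => WithTop.coe_le_coe.mpr (Nat.zero_le _)
      rw [hmin]
      rfl

/-- On the `R = 0` shell the insertion field vanishes unless `T = ∅` (the pair sector). [folklore] -/
theorem field_eq_zero_of_voidRadius_eq_zero [NeZero L] (ψ : TensorIndex (TorusSite 3 L) 2 → ℂ)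
    {T : Finset (TorusSite 3 L)} (hT : T ≠ ∅) {x : TorusSite 3 L}
    (h : ((T.image fun t => (torusGraph 3 L).dist x t).min.untopD 0) = 0) : field ψ T x = 0 := by
  rcases (voidRadius_eq_zero_iff T x).mp h with h' | h'
  · exact absurd h' hT
  · exact field_eq_zero_of_mem ψ T h'

/-- **The void radius is less than the number of sites** (`L³`): a geodesic is a path.
[folklore] -/
theorem voidRadius_lt_card [NeZero L] (T : Finset (TorusSite 3 L)) (x : TorusSite 3 L) :
    ((T.image fun t => (torusGraph 3 L).dist x t).min.untopD 0) < L ^ 3 := by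
  have hL : 0 < L ^ 3 := pow_pos (Nat.pos_of_ne_zero (NeZero.ne L)) 3
  by_cases hT : T = ∅
  · subst hT
    rw [Finset.image_empty, Finset.min_empty, WithTop.untopD_top]
    exact hL
  · obtain ⟨t₀, ht₀⟩ := Finset.nonempty_iff_ne_empty.mpr hT
    obtain ⟨b, hb⟩ :=
      Finset.min_of_mem (Finset.mem_image_of_mem (fun t => (torusGraph 3 L).dist x t) ht₀)
    rw [hb]
    change b < L ^ 3
    obtain ⟨t, -, rfl⟩ := Finset.mem_image.mp (Finset.mem_of_min hb)
    obtain ⟨p, hp⟩ := ((torusGraph_connected 3 L).preconnected x t).exists_isPath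
    calc (torusGraph 3 L).dist x t ≤ p.length := SimpleGraph.dist_le p
      _ < Fintype.card (TorusSite 3 L) := hp.length_lt
      _ = L ^ 3 := card_torusSite 3 L

/-- **Shell partition** (first step of `stub_transfer`): a sum over sites is the sum over the void
radius shells `R = 0, …, L³ - 1`. [folklore] -/
theorem shell_partition [NeZero L] (T : Finset (TorusSite 3 L)) (f : TorusSite 3 L → ℝ) :
    ∑ x, f x = ∑ R ∈ Finset.range (L ^ 3), ∑ x : TorusSite 3 L,
      if ((T.image fun t => (torusGraph 3 L).dist x t).min.untopD 0) = R then f x else 0 := by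
  rw [Finset.sum_comm]
  refine Finset.sum_congr rfl fun x _ => ?_
  rw [Finset.sum_ite_eq (Finset.range (L ^ 3)) _ (fun _ => f x),
    if_pos (Finset.mem_range.mpr (voidRadius_lt_card T x))]

/-- The same partition for the double sum over configurations and sites. [folklore] -/
theorem shell_partition_sum [NeZero L] (𝒯 : Finset (Finset (TorusSite 3 L)))
    (f : Finset (TorusSite 3 L) → TorusSite 3 L → ℝ) :
    ∑ T ∈ 𝒯, ∑ x, f T x = ∑ R ∈ Finset.range (L ^ 3), ∑ T ∈ 𝒯, ∑ x : TorusSite 3 L,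
      if ((T.image fun t => (torusGraph 3 L).dist x t).min.untopD 0) = R then f T x else 0 := by
  rw [Finset.sum_congr rfl fun T _ => shell_partition T (f T)]
  exact Finset.sum_comm

/-- **Shell inside tail**: for nonnegative weights the shell `ρ = R + 1` is part of the tail `ρ > R`
(how `stub_transfer` consumes `stub_voidTail`). [folklore] -/
theorem shell_le_tail [NeZero L] (T : Finset (TorusSite 3 L)) (w : TorusSite 3 L → ℝ) (hw : ∀ x, 0 ≤ w x)
    (R : ℕ) :
    (∑ x : TorusSite 3 L,
        if ((T.image fun t => (torusGraph 3 L).dist x t).min.untopD 0) = R + 1 then w x else 0) ≤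
      ∑ x : TorusSite 3 L,
        if R < ((T.image fun t => (torusGraph 3 L).dist x t).min.untopD 0) then w x else 0 := by
  refine Finset.sum_le_sum fun x _ => ?_
  by_cases h : ((T.image fun t => (torusGraph 3 L).dist x t).min.untopD 0) = R + 1
  · rw [if_pos h, if_pos (by omega)]
  · rw [if_neg h]
    split_ifs
    · exact hw x
    · exact le_rfl

/-- **Tails are nested**: `ρ > R + 1` implies `ρ > R` (nonnegative weights). [folklore] -/
theorem tail_mono [NeZero L] (T : Finset (TorusSite 3 L)) (w : TorusSite 3 L → ℝ) (hw : ∀ x, 0 ≤ w x)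
    (R : ℕ) :
    (∑ x : TorusSite 3 L,
        if R + 1 < ((T.image fun t => (torusGraph 3 L).dist x t).min.untopD 0) then w x else 0) ≤
      ∑ x : TorusSite 3 L,
        if R < ((T.image fun t => (torusGraph 3 L).dist x t).min.untopD 0) then w x else 0 := by
  refine Finset.sum_le_sum fun x _ => ?_
  by_cases h : R + 1 < ((T.image fun t => (torusGraph 3 L).dist x t).min.untopD 0)
  · rw [if_pos h, if_pos (by omega)]
  · rw [if_neg h]
    split_ifs
    · exact hw x
    · exact le_rfl

/-- The tail at `R = 0` is everything off `T` when `T ≠ ∅`: `ρ_T(x) > 0 ↔ x ∉ T`. [folklore] -/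
theorem voidRadius_pos_iff {T : Finset (TorusSite 3 L)} (hT : T ≠ ∅) (x : TorusSite 3 L) :
    0 < ((T.image fun t => (torusGraph 3 L).dist x t).min.untopD 0) ↔ x ∉ T := by
  rw [Nat.pos_iff_ne_zero, Ne, voidRadius_eq_zero_iff]
  tauto

end Summit.AtomisticToContinuum.BoseEinsteinCondensation.Theorems.InsertionFieldDelocalisation.Negative

end
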